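import Summits.AtomisticToContinuum.Crystallization.Theorems.FrustratedLawDichotomyCellClasses

/-!
# FrustratedLawDichotomy · crux `AperiodicFrustratedLawGap` (stmt-AtomisticToContinuum-27623) — CELL-SOUND XIV: SEPARATION AND LIST RADII OF
A GENERAL LINEAR TEMPLATE (cell decomp-a2c, lens-5 g113; for the BINDING cell F1 = diag(0.895,1,1)-fcc, census N9′-F1-54, KFILE-FORMAT ed2 §1)

(261) `sep_of_linTemplate` asks the template matrix `T` to be near the identity (`|TᵀT − 1| ≤ η`, `3η ≤ 1`); a STRAINED AND SCALED template
(`T = diag(10477/16384, 5853/8192, 5853/8192)`, `TᵀT ≈ diag(0.41, 0.51, 0.51)`) is not.  Here the lower bound of the template form comes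
from a GERSHGORIN row condition on the exact rational `G = TᵀT`: ★ `gram_ge_of_rows` (`λ·|v|² ≤ gram G v v` when `λ ≤ rowSlack G i` for
the three rows — the diagonal entry minus the half-sum of the absolute off-diagonal entries of its row and column; `rowSlackQ`/`rowSlack_map`
decide it in `ℚ`), hence ★ `sep_of_linTemplate_rows` (the doors'
all-pairs separation clause from injectivity + ONE numeric fact `c < k·λ`), ★ `le_dist_of_linRadius` / `le_norm_of_linRadius` (the (261)
list side conditions for `a m = T·z m` from an INTEGER radius `ℓ ≤ |Δz|²` and `L² ≤ (1 − 3ε)·λ·ℓ`), and `transpose_mul_map`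
(the cast of the rational `TᵀT`).  For diagonal `T` the row condition is `λ ≤ min Tᵢᵢ²` exactly; for sheared cells it is lossy by `O(shear)` — a cost, never a
soundness issue.

House conventions: SI units · italic scalars, bold vectors, sans-serif tensors · numbered formulae only when referenced · en-dash for
ranges · References = cited works, numbered, alphabetical · no footnotes; Remarks at section ends · British spelling, -ise · Lennard-Jones
hyphenated; NASH capitalised as the Statement's notion · "folklore" tags standard bookkeeping; no new references are cited in this file.
-/

noncomputable section

namespace Summit.AtomisticToContinuum.Crystallization.Theorems.FrustratedLawDichotomyCellLinSep

open scoped BigOperators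
open Summit.AtomisticToContinuum.Crystallization.Theorems.FrustratedLawDichotomyCellMetric (posL gram norm_sq_posL dist_posL)
open Summit.AtomisticToContinuum.Crystallization.Theorems.FrustratedLawDichotomyCellAdmissible (le_norm_posL')
open Summit.AtomisticToContinuum.Crystallization.Theorems.FrustratedLawDichotomyCellData (gram_ge_nearId)
open Summit.AtomisticToContinuum.Crystallization.Theorems.FrustratedLawDichotomyCellClasses (sumSq_linTemplate one_le_sumSq_sub_of_ne)

variable {ι : Type*}

/-- the GERSHGORIN ROW SLACK of index `i`: the diagonal entry minus the half-sum of the absolute off-diagonal entries of row `i` and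
column `i` (written as a full sum so that no index bookkeeping is needed: `Gᵢᵢ + |Gᵢᵢ| − ½Σⱼ(|Gᵢⱼ| + |Gⱼᵢ|)`). -/
def rowSlack (G : Matrix (Fin 3) (Fin 3) ℝ) (i : Fin 3) : ℝ := G i i + |G i i| - (∑ j, (|G i j| + |G j i|)) / 2

/-- the same over `ℚ` (decide it there, cast it here: `rowSlack_map`). -/
def rowSlackQ (G : Matrix (Fin 3) (Fin 3) ℚ) (i : Fin 3) : ℚ := G i i + |G i i| - (∑ j, (|G i j| + |G j i|)) / 2

omit ι in
/-- [folklore] -/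
theorem rowSlack_map (G : Matrix (Fin 3) (Fin 3) ℚ) (i : Fin 3) : rowSlack (G.map fun q : ℚ => (q : ℝ)) i = (rowSlackQ G i : ℝ) := by
  simp only [rowSlack, rowSlackQ, Matrix.map_apply]; push_cast; rfl

omit ι in
/-- `TᵀT` of a rational template is the cast of the rational `TᵀT`. [folklore] -/
theorem transpose_mul_map (TQ : Matrix (Fin 3) (Fin 3) ℚ) :
    (TQ.map fun q : ℚ => (q : ℝ)).transpose * (TQ.map fun q : ℚ => (q : ℝ)) = (TQ.transpose * TQ).map fun q : ℚ => (q : ℝ) := by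
  ext i j
  simp only [Matrix.mul_apply, Matrix.transpose_apply, Matrix.map_apply]
  push_cast
  rfl

omit ι in
/-- a product is at least minus the product of absolute values, and `|x||y| ≤ (x² + y²)/2`. [folklore] -/
theorem mul_mul_ge (c x y : ℝ) : -(|c| * ((x ^ 2 + y ^ 2) / 2)) ≤ c * (x * y) := by
  have h1 : -(|c| * |x * y|) ≤ c * (x * y) := by
    rw [← abs_mul]; exact neg_abs_le _
  have h2 : |x * y| ≤ (x ^ 2 + y ^ 2) / 2 := by
    rw [abs_mul]
    nlinarith [sq_abs x, sq_abs y, sq_nonneg (|x| - |y|), abs_nonneg x, abs_nonneg y]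
  nlinarith [abs_nonneg c]

omit ι in
/-- ★ GERSHGORIN LOWER BOUND of a `3 × 3` form: `λ·Σ vᵢ² ≤ gram G v v` when `λ ≤ rowSlack G i` for the three rows. [folklore] -/
theorem gram_ge_of_rows {G : Matrix (Fin 3) (Fin 3) ℝ} {lam : ℝ} (hG : ∀ i, lam ≤ rowSlack G i) (v : Fin 3 → ℝ) :
    lam * ∑ i, v i ^ 2 ≤ gram G v v := by
  have h0 := hG 0; have h1 := hG 1; have h2 := hG 2
  simp only [rowSlack, Fin.sum_univ_three, Fin.isValue] at h0 h1 h2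
  unfold gram
  simp only [Fin.sum_univ_three]
  have a01 := mul_mul_ge (G 0 1) (v 0) (v 1)
  have a10 := mul_mul_ge (G 1 0) (v 1) (v 0)
  have a02 := mul_mul_ge (G 0 2) (v 0) (v 2)
  have a20 := mul_mul_ge (G 2 0) (v 2) (v 0)
  have a12 := mul_mul_ge (G 1 2) (v 1) (v 2)
  have a21 := mul_mul_ge (G 2 1) (v 2) (v 1)
  have s0 := sq_nonneg (v 0); have s1 := sq_nonneg (v 1); have s2 := sq_nonneg (v 2)
  have d0 := mul_le_mul_of_nonneg_right h0 s0
  have d1 := mul_le_mul_of_nonneg_right h1 s1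
  have d2 := mul_le_mul_of_nonneg_right h2 s2
  nlinarith [d0, d1, d2, a01, a10, a02, a20, a12, a21, abs_nonneg (G 0 0), abs_nonneg (G 1 1), abs_nonneg (G 2 2)]

/-! ## Separation and list radii -/

/-- ★ STRUCTURAL ALL-PAIRS SEPARATION of a general linear template `a m = T·z m`: injectivity of `z` on `M`, the row condition of `TᵀT`
at level `λ ≥ 0`, and ONE numeric fact `c < k·λ`. [folklore] -/
theorem sep_of_linTemplate_rows {z : ι → Fin 3 → ℤ} {M : Finset ι} (hinj : ∀ m ∈ M, ∀ m' ∈ M, m ≠ m' → z m ≠ z m')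
    (T : Matrix (Fin 3) (Fin 3) ℝ) {lam c k : ℝ} (hT : ∀ i, lam ≤ rowSlack (T.transpose * T) i) (hlam : 0 ≤ lam) (hk : 0 ≤ k)
    (hc : c < k * lam) :
    ∀ m ∈ M, ∀ m' ∈ M, m ≠ m' → c < k * ∑ i, (T.mulVec (fun j => (z m j : ℝ)) i - T.mulVec (fun j => (z m' j : ℝ)) i) ^ 2 := by
  intro m hm m' hm' hne
  have hsub : ∀ i, T.mulVec (fun j => (z m j : ℝ)) i - T.mulVec (fun j => (z m' j : ℝ)) i
      = T.mulVec (fun j => ((z m j - z m' j : ℤ) : ℝ)) i := by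
    intro i; rw [← Pi.sub_apply, ← Matrix.mulVec_sub]; push_cast; rfl
  simp_rw [hsub]
  rw [sumSq_linTemplate]
  have h1 : (1 : ℝ) ≤ ∑ j, ((z m j - z m' j : ℤ) : ℝ) ^ 2 := by
    have := one_le_sumSq_sub_of_ne (hinj m hm m' hm' hne)
    exact_mod_cast this
  have h2 := gram_ge_of_rows hT (fun j => ((z m j - z m' j : ℤ) : ℝ))
  have h3 : 0 ≤ k * lam := mul_nonneg hk hlam
  calc c < k * lam := hc
    _ = k * lam * 1 := by ring
    _ ≤ k * lam * ∑ j, ((z m j - z m' j : ℤ) : ℝ) ^ 2 := mul_le_mul_of_nonneg_left h1 h3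
    _ = k * (lam * ∑ j, ((z m j - z m' j : ℤ) : ℝ) ^ 2) := by ring
    _ ≤ k * gram (T.transpose * T) (fun j => ((z m j - z m' j : ℤ) : ℝ)) (fun j => ((z m j - z m' j : ℤ) : ℝ)) :=
        mul_le_mul_of_nonneg_left h2 hk

section NearId

variable {F : Matrix (Fin 3) (Fin 3) ℝ} {ε : ℝ}

/-- the placed template form: `‖F (T v)‖² ≥ (1 − 3ε)·λ·Σ vᵢ²` on the strain box. [folklore] -/
theorem normSq_posL_mulVec_ge (hG : ∀ i j, |(F.transpose * F) i j - (if i = j then 1 else 0)| ≤ ε) (hε : 0 ≤ 1 - 3 * ε)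
    (T : Matrix (Fin 3) (Fin 3) ℝ) {lam : ℝ} (hT : ∀ i, lam ≤ rowSlack (T.transpose * T) i) (v : Fin 3 → ℝ) :
    (1 - 3 * ε) * (lam * ∑ i, v i ^ 2) ≤ ‖posL F (T.mulVec v)‖ ^ 2 := by
  rw [norm_sq_posL]
  refine le_trans ?_ (gram_ge_nearId hG (T.mulVec v))
  refine mul_le_mul_of_nonneg_left ?_ hε
  have := gram_ge_of_rows hT v
  have hsq : ∑ i, T.mulVec v i ^ 2 = gram (T.transpose * T) v v := by
    rw [← norm_sq_posL]
    unfold posL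
    rw [EuclideanSpace.norm_eq, Real.sq_sqrt (Finset.sum_nonneg fun i _ => by positivity)]
    simp [Real.norm_eq_abs, sq_abs]
  rw [hsq]; exact this

/-- ★ LIST SIDE CONDITION for a linear template: labels outside the integer ball `ℓ ≤ |Δz|²` are `≥ L` apart once `L² ≤ (1 − 3ε)·λ·ℓ`.
[folklore] -/
theorem le_dist_of_linRadius (hG : ∀ i j, |(F.transpose * F) i j - (if i = j then 1 else 0)| ≤ ε) (hε : 0 ≤ 1 - 3 * ε)
    (T : Matrix (Fin 3) (Fin 3) ℝ) {lam : ℝ} (hT : ∀ i, lam ≤ rowSlack (T.transpose * T) i) (hlam : 0 ≤ lam)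
    {z z' : Fin 3 → ℤ} {L : ℝ} {ℓ : ℤ} (hL : L ^ 2 ≤ (1 - 3 * ε) * lam * ℓ) (hzz : ℓ ≤ ∑ i, (z i - z' i) ^ 2) :
    L ≤ dist (posL F (T.mulVec fun j => (z j : ℝ))) (posL F (T.mulVec fun j => (z' j : ℝ))) := by
  rw [dist_posL, ← Matrix.mulVec_sub]
  have hv : ((fun j => (z j : ℝ)) - fun j => (z' j : ℝ)) = fun j => ((z j - z' j : ℤ) : ℝ) := by
    funext j; push_cast; rfl
  rw [hv]
  have h1 : (ℓ : ℝ) ≤ ∑ j, ((z j - z' j : ℤ) : ℝ) ^ 2 := by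
    have : (ℓ : ℝ) ≤ ((∑ i, (z i - z' i) ^ 2 : ℤ) : ℝ) := by exact_mod_cast hzz
    simpa using this
  have h2 := normSq_posL_mulVec_ge hG hε T hT (fun j => ((z j - z' j : ℤ) : ℝ))
  have h3 : L ^ 2 ≤ ‖posL F (T.mulVec fun j => ((z j - z' j : ℤ) : ℝ))‖ ^ 2 := by
    calc L ^ 2 ≤ (1 - 3 * ε) * lam * ℓ := hL
      _ ≤ (1 - 3 * ε) * lam * ∑ j, ((z j - z' j : ℤ) : ℝ) ^ 2 := mul_le_mul_of_nonneg_left h1 (mul_nonneg hε hlam)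
      _ = (1 - 3 * ε) * (lam * ∑ j, ((z j - z' j : ℤ) : ℝ) ^ 2) := by ring
      _ ≤ _ := h2
  rw [norm_sq_posL] at h3
  exact le_norm_posL' h3

/-- ★ the same for the distance from the root: `L ≤ ‖F (T z)‖` once `L² ≤ (1 − 3ε)·λ·ℓ`, `ℓ ≤ |z|²`. [folklore] -/
theorem le_norm_of_linRadius (hG : ∀ i j, |(F.transpose * F) i j - (if i = j then 1 else 0)| ≤ ε) (hε : 0 ≤ 1 - 3 * ε)
    (T : Matrix (Fin 3) (Fin 3) ℝ) {lam : ℝ} (hT : ∀ i, lam ≤ rowSlack (T.transpose * T) i) (hlam : 0 ≤ lam)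
    {z : Fin 3 → ℤ} {L : ℝ} {ℓ : ℤ} (hL : L ^ 2 ≤ (1 - 3 * ε) * lam * ℓ) (hz : ℓ ≤ ∑ i, z i ^ 2) :
    L ≤ ‖posL F (T.mulVec fun j => (z j : ℝ))‖ := by
  have h1 : (ℓ : ℝ) ≤ ∑ j, ((z j : ℤ) : ℝ) ^ 2 := by
    have : (ℓ : ℝ) ≤ ((∑ i, z i ^ 2 : ℤ) : ℝ) := by exact_mod_cast hz
    simpa using this
  have h2 := normSq_posL_mulVec_ge hG hε T hT (fun j => (z j : ℝ))
  have h3 : L ^ 2 ≤ ‖posL F (T.mulVec fun j => (z j : ℝ))‖ ^ 2 := by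
    calc L ^ 2 ≤ (1 - 3 * ε) * lam * ℓ := hL
      _ ≤ (1 - 3 * ε) * lam * ∑ j, ((z j : ℤ) : ℝ) ^ 2 := mul_le_mul_of_nonneg_left h1 (mul_nonneg hε hlam)
      _ = (1 - 3 * ε) * (lam * ∑ j, ((z j : ℤ) : ℝ) ^ 2) := by ring
      _ ≤ _ := h2
  rw [norm_sq_posL] at h3
  exact le_norm_posL' h3

end NearId

end Summit.AtomisticToContinuum.Crystallization.Theorems.FrustratedLawDichotomyCellLinSep

end
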